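import Summits.QuantumFields.YangMills.Theorems.BalabanUVNodesN11FibrewiseIdentityOfFibreChart
import Summits.QuantumFields.YangMills.Theorems.BalabanUVNodesN11ChartReadingOfKeptSplit

/-!
# DAG node N11 — THE (O3′) CLAUSE AT THE STAGE-13 LETTERS FROM SPLIT FIBRE CHARTS AND (3.23) POINTWISE IN THE KEPT FLUCTUATION VARIABLES
# (all levels `k < K`; the first 𝐓-step is the sequel `…N11FirstTStepO3OfSplitCharts`) — per `(s′, S₀, y)`: a chart `(τ, Ψ, J, S)` with coordinates (kept `a`, integrated `x`), `hpush`, `hsec`, support, and ONE identity per `(v, a)`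

HEADER — WORK-UNIT METADATA.  Cell `pub-ymgap`, YM-PLAN Track A (D-0062), seat `pub-ymgap-dag-n11-d` (g17; N11 [B14], s2), route `BalabanUVNodes`, item K1⁹ = stmt-QuantumFields-27364
(helper lane, `--kind proof --supports 27364 --as helper`, count-neutral).  [I] = [Balaban1987RG1], [II] = [Balaban1988RG2Cluster], [III] = [Balaban1988Convergent], [15] =
[Balaban1985Variational].  Composition BY NAME of this seat's g17 `…N11FibrewiseIdentityOfFibreChart` (`condExp_identity_of_fibreCharts_of_nonneg`, a `y`-parametrised chart family)
and `…N11ChartReadingOfKeptSplit` (`reading_of_keptSplit_at_record`: the reading from (3.23) pointwise in the kept variables) with p639540 ∕ p640513 (the (O3′) clause from (hce₀));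
row discharges VERBATIM as in p646357 (+ `measurable_tkWeightsOfRecordP_ζ ∕ _w` for the new weights, `Measure.compProd_const`, `Kernel.const_apply`).

WHY THIS FILE.  After this seat's g16–g17 files the (O3′) debt of a §3 supplier is, per 𝐓-present child `s′`, old branch `S₀` and a.e. frozen retained configuration `y`,
ONE fibrewise identity; print proves it by a chart of the inside variables whose coordinates are the new fluctuation field `A` on `B(Ω_{k+1})` = (KEPT `a` on `Ω_{k+1} ∖ Λ_{k+1}`,
which 11a's generation `𝐓^{(k)}` integrates later with the A-weight `χ·e^{−½⟨a,𝒬a⟩}`) × (INTEGRATED `x` on `Λ_{k+1}`), and by PERFORMING the `x`-integral at fixed `a`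
([III] (3.16)–(3.23), Thm 2's re-expansion; [I] Thm 1 + [II] at the first step).  THIS FILE states the (O3′) clause with exactly that burden displayed and NOTHING ELSE analytic:
per `(s′, S₀)` and a.e. `y` SEPARATELY — `Ψ`, `J` measurable; `hpush` for `dv ⊗ (da ⊗ τ)`; `hsec`; the support clause; and (hpt) «for a.e. `(v, a)`:
∫ J(v,a,x)·piece_{S₀}(e⁻¹(y,Ψ(v,a,x))) dτ(x) = ζ_k(Ω^c_{k+1})(ω_{y,v}) · Σ_Y w_k(Λ_{k+1}, Λ^c_{k+1}∩Ω_{k+1}, Y)(ω^a_{y,v}) · (𝐓_k(init s′,S₀)[W′] e^{A_{k+1}(s′,S₀∪Y)})(ω^a_{y,v})».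

WHAT THIS FILE PROVES (0 `def`, 0 `sorry`, standard axioms).  ★★★ `slotsTOfRecord₁₃H_succ_O3_of_hasSect2FormAtZS_of_splitCharts_of_provisos` (Stage 13, every level `k < K`); the
first 𝐓-step (old piece `w(s′)·ρ₀`, old branch `∅`) is `…N11FirstTStepO3OfSplitCharts.slotsTOfRecord₁₃H_one_O3_of_splitChartsRho_of_provisos`.

HONEST FRAMING.  Helper lane of K1⁹; count-neutral; compositions BY NAME; the split charts, `hpush`, `hsec`, the support clause and (hpt) are HYPOTHESES — (hpt) IS [III]
(3.16)–(3.23) ∘ Thm 2 ([I] Thm 1 + [II] at the first step), the charts ARE [I] §2 + [15] Sect. C — NOT proved; NO chart constructed, NO Jacobian computed, NO Gaussian integration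
performed; nothing of Bałaban asserted; N11 NOT discharged; K1⁹ NOT closed, no registered stub touched; counts unmoved (typed 28∕28 · discharged 5∕27 · A 5∕28).  One finite
`𝕋⁴_{L^K}` programme at fixed `ε = L^{−K}` — NOT ℝ⁴, NOT OS, NOT a mass gap, NOT Clay.  No `sorry`, `axiom`, `def`, `instance`, `notation`.  Sources (SHAPE only): [III] Thm 1 p.262,
Thm 2 p.263, (2.18) p.257, (2.20)–(2.21) p.258, (3.1) p.264, (3.10)–(3.11) p.266, (3.12)–(3.14) p.267, (3.16)–(3.25) pp.268–270, §3 p.279; [I] Thm 1 p.258, (0.4) p.253, §2 p.267; [15] (47)–(49) pp.287–288.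
-/

noncomputable section

open MeasureTheory ProbabilityTheory
open scoped ENNReal NNReal BigOperators Matrix.Norms.L2Operator

namespace Summit.QuantumFields.YangMills.Theorems.BalabanUVNodesN11O3OfSplitChartsAtRecord13

open Literature.MathematicalPhysics.QuantumFieldTheory.Balaban1983to89
open Literature.MathematicalPhysics.QuantumFieldTheory.Balaban1983to89.T4AveragingDisintegration
open BalabanUVNodesN11FibrewiseIdentityOfFibreChart (condExp_identity_of_fibreCharts_of_nonneg)
open BalabanUVNodesN11ChartReadingOfKeptSplit (reading_of_keptSplit_at_record)
open BalabanUVNodesN11TkOpMeasurable (measurable_tkWeightsOfRecordP_ζ measurable_tkWeightsOfRecordP_w)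
open T4AdjointCovariance (insA)
open BalabanUVNodesN11O3OfIntrinsicReading (measurable_intrinsicReading_of_hgm)
open BalabanUVNodesN11O3OfIntrinsicReadingAtRecord13 (slotsTOfRecord₁₃H_succ_O3_of_hasSect2FormAtZS_of_oldBranchCondExp_of_provisos)
open BalabanUVNodesN11FirstTStepO3OfIntrinsicReading (slotsTOfRecord₁₃H_one_O3_of_condExpRho_of_provisos)
open BalabanUVNodesN11TStepGraphIntegrableOfProvisos (hG_at_record₁₃_of_provisos)
open BalabanUVNodesN11TStepOldBranchGraphIntegrable (integrable_oldBranch_pieces₁₃H_of_integrable_graph tkBranchOfRecord_nonneg)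
open BalabanUVNodesN11TStepBranchSumAtRecord13OfLaws (hgm_at_record₁₃_of_rows)
open N21StepWeightsPositivity (zetaOfRecord_nonneg)
open Literature.MathematicalPhysics.QuantumFieldTheory.Balaban1983to89.B14SeparationOfRecord (slotsTOfRecord_succ_eq_zero_of_init_eq_zero)
open Node00 hiding SU
open Node00.Tk T4Continuum B14.Eq218Concrete
open B10Eq42TorusConstraint (bondsIn)

variable {F : T4Family} {N : ℕ} [NeZero N]

/-! ## Stage-13 letters at the core provisos: the (O3′) disjunction from split charts and (3.23) pointwise, per old branch -/

section Stage13
/-- ★★★ **THE (O3′) DISJUNCTION OF `PresentChildObligations` FROM THEOREM 1's LEVEL-`k` FORM, THE CORE PROVISOS, ROWS, AND — PER OLD BRANCH AND FROZEN `y` — A SPLIT FIBRE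
CHART WITH (3.23) POINTWISE IN THE KEPT VARIABLES** (the frozen-`y` identity produced by `condExp_identity_of_fibreCharts_of_nonneg` ∘ `reading_of_keptSplit_at_record`) —
p646357 §2 with the weak identity produced by the Fubini reduction `condExp_identity_of_fibrewise_of_nonneg` (`R̃_{S₀} ≥ 0`, measurable, the piece `dU`-integrable: theorems of the
provisos as there).  The displayed identity: for a.e. frozen `y = U|_{B_k(Ω^c_{k+1})}` and every bounded measurable `h` of the new variables `v₂` alone,
`∫ piece_{S₀}(e⁻¹(y,u))·h(Ū(e⁻¹(y,u))|_{new}) du = ∫ R̃_{S₀}(y,v₂)·h(v₂) dv₂`. [cite: Balaban1988Convergent, Thm 1 p.262, Thm 2 p.263, §3 p.279, (3.1) p.264, (3.10)–(3.11) p.266, (3.12)–(3.14) p.267, (3.23)–(3.25) p.270; Balaban1987RG1, (0.4) p.253, §2 p.267] -/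
theorem slotsTOfRecord₁₃H_succ_O3_of_hasSect2FormAtZS_of_splitCharts_of_provisos (θ : Stage13HParams F N) (h : θ.Provisos₁₃CoPH F N)
    (p : B12.RunParams) {k : ℕ} (hkK : k < p.K)
    {hdec : DecidableEq (PBond (F.P p.K) k)} {hdec' : DecidableEq (PBond (F.P p.K) (k + 1))} (hk : k + 1 ≤ (F.P p.K).m + (F.P p.K).K)
    (s' : SeqOfRecord F θ.ν θ.τ9.M (gOfRecord₁₃ F N θ.toStage13Params p) p.K (k + 1))
    {law : SeqOfRecord F θ.ν θ.τ9.M (gOfRecord₁₃ F N θ.toStage13Params p) p.K k → Sect2.TermValues (F.P p.K) (MatA N) (FluctV N) θ.τ9.M → Prop}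
    {t : SeqOfRecord F θ.ν θ.τ9.M (gOfRecord₁₃ F N θ.toStage13Params p) p.K k → Sect2.TermValues (F.P p.K) (MatA N) (FluctV N) θ.τ9.M}
    {Ek : SeqOfRecord F θ.ν θ.τ9.M (gOfRecord₁₃ F N θ.toStage13Params p) p.K k → ℝ}
    (hform : HasSect2FormAtZS F N (FluctV N) p.K (settingOfRecord₁₃ F N θ.toStage13Params p) k (θ.rzAt p) (WtOfRecord₁₃H F N θ p)
      (UbgOfRecord₁₃CoP F N θ.toStage13Params p k) law
      (slotsOfRecord F N θ.ν θ.τ9 (EOfRecord₁₃ F N θ.toStage13Params) (wOfRecord₉ F N θ.toStage9Params) θ.ppSel p (gOfRecord₁₃ F N θ.toStage13Params p) k) t Ek)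
    (t' : Sect2.TermValues (F.P p.K) (MatA N) (FluctV N) θ.τ9.M) (E' : ℝ)
    (hζ0m : ∀ j Y, Measurable ((θ.zhAt p s'.init).ζ0 j Y)) (hqm : ∀ j Λ', Measurable ((θ.zhAt p s'.init).quad j Λ'))
    (hΦ₀m : ∀ S₀ ∈ admSOfRecord F θ.ν θ.τ9.M (gOfRecord₁₃ F N θ.toStage13Params p) p.K k s'.init,
      Measurable fun ω : MultiCfg (F.P p.K) (SU N) (FluctV N) =>
        (sect2Operand F N (FluctV N) p.K (settingOfRecord₁₃ F N θ.toStage13Params p) (θ.rzAt p s'.init) s'.init (t s'.init) (Ek s'.init)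
            (UbgOfRecord₁₃CoP F N θ.toStage13Params p k s'.init)) (S₀, fun j => (ω j).2) (fun j => (ω j).1))
    (hζm : ∀ j Y, Measurable ((θ.zhAt p s').ζ0 j Y)) (hqm' : ∀ j Λ', Measurable ((θ.zhAt p s').quad j Λ'))
    (hΦm : ∀ S ∈ admSOfRecord F θ.ν θ.τ9.M (gOfRecord₁₃ F N θ.toStage13Params p) p.K (k + 1) s',
      Measurable fun ω : MultiCfg (F.P p.K) (SU N) (FluctV N) =>
        (sect2Operand F N (FluctV N) p.K (settingOfRecord₁₃ F N θ.toStage13Params p) (θ.rzAt p s') s' t' E'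
                  (UbgOfRecord₁₃CoP F N θ.toStage13Params p (k + 1) s')) (S, fun j => (ω j).2) (fun j => (ω j).1))
    {X : Type*} [MeasurableSpace X]
    (τ : (ℕ → Set (Site (F.P p.K) 0)) → (↥(Set.toFinite (bondsIn k (s'.Ω (k + 1))ᶜ)).toFinset → SU N) → Measure X) [hτ : ∀ S₀ y, SFinite (τ S₀ y)]
    (Ψ : (ℕ → Set (Site (F.P p.K) 0)) → (↥(Set.toFinite (bondsIn k (s'.Ω (k + 1))ᶜ)).toFinset → SU N) → ({c : PBond (F.P p.K) (k + 1) // c ∉ (Set.toFinite (bondsIn (k + 1) (s'.Ω (k + 1))ᶜ)).toFinset} → SU N) × ((↥(Set.toFinite (bondsIn k ((s'.Λ (k + 1))ᶜ ∩ s'.Ω (k + 1)))).toFinset → FluctV N) × X) → ({b : PBond (F.P p.K) k // b ∉ (Set.toFinite (bondsIn k (s'.Ω (k + 1))ᶜ)).toFinset} → SU N))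
    (J : (ℕ → Set (Site (F.P p.K) 0)) → (↥(Set.toFinite (bondsIn k (s'.Ω (k + 1))ᶜ)).toFinset → SU N) → ({c : PBond (F.P p.K) (k + 1) // c ∉ (Set.toFinite (bondsIn (k + 1) (s'.Ω (k + 1))ᶜ)).toFinset} → SU N) × ((↥(Set.toFinite (bondsIn k ((s'.Λ (k + 1))ᶜ ∩ s'.Ω (k + 1)))).toFinset → FluctV N) × X) → ℝ≥0)
    (Sc : (ℕ → Set (Site (F.P p.K) 0)) → (↥(Set.toFinite (bondsIn k (s'.Ω (k + 1))ᶜ)).toFinset → SU N) → Set ({b : PBond (F.P p.K) k // b ∉ (Set.toFinite (bondsIn k (s'.Ω (k + 1))ᶜ)).toFinset} → SU N))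
    -- PER OLD BRANCH AND FROZEN `y`: A SPLIT CHART (kept `a` ∕ integrated `x`), ITS SUPPORT CLAUSE, AND (3.23) POINTWISE IN `(v, a)` — nothing asked in `y`
    (hsplit : ∀ S₀ ∈ admSOfRecord F θ.ν θ.τ9.M (gOfRecord₁₃ F N θ.toStage13Params p) p.K k s'.init,
      ∀ᵐ y ∂(Measure.pi fun _ : ↥(Set.toFinite (bondsIn k (s'.Ω (k + 1))ᶜ)).toFinset => (HaarData.haar : Measure (SU N))),
      Measurable (Ψ S₀ y) ∧ Measurable (J S₀ y) ∧
      (((Measure.pi fun _ : {c : PBond (F.P p.K) (k + 1) // c ∉ (Set.toFinite (bondsIn (k + 1) (s'.Ω (k + 1))ᶜ)).toFinset} => (HaarData.haar : Measure (SU N))).prod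
          ((Measure.pi fun _ : ↥(Set.toFinite (bondsIn k ((s'.Λ (k + 1))ᶜ ∩ s'.Ω (k + 1)))).toFinset => (volume : Measure (FluctV N))).prod (τ S₀ y))).withDensity
          (fun z => (J S₀ y z : ℝ≥0∞))).map (Ψ S₀ y) =
        (Measure.pi fun _ : {b : PBond (F.P p.K) k // b ∉ (Set.toFinite (bondsIn k (s'.Ω (k + 1))ᶜ)).toFinset} => (HaarData.haar : Measure (SU N))).restrict (Sc S₀ y) ∧
      (∀ᵐ z ∂(((Measure.pi fun _ : {c : PBond (F.P p.K) (k + 1) // c ∉ (Set.toFinite (bondsIn (k + 1) (s'.Ω (k + 1))ᶜ)).toFinset} => (HaarData.haar : Measure (SU N))).prod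
          ((Measure.pi fun _ : ↥(Set.toFinite (bondsIn k ((s'.Λ (k + 1))ᶜ ∩ s'.Ω (k + 1)))).toFinset => (volume : Measure (FluctV N))).prod (τ S₀ y))).withDensity
          (fun z => (J S₀ y z : ℝ≥0∞))),
        (fun c : {c : PBond (F.P p.K) (k + 1) // c ∉ (Set.toFinite (bondsIn (k + 1) (s'.Ω (k + 1))ᶜ)).toFinset} =>
          (avOfRecord F N p.K k).avg ((MeasurableEquiv.piEquivPiSubtypeProd (fun _ : PBond (F.P p.K) k => SU N)
              (· ∈ (Set.toFinite (bondsIn k (s'.Ω (k + 1))ᶜ)).toFinset)).symm (y, Ψ S₀ y z)) c) = z.1) ∧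
      (∀ u, u ∉ Sc S₀ y → (fun U => wOfRecord₉ F N θ.toStage9Params p (gOfRecord₁₃ F N θ.toStage13Params p) k s' U ((avOfRecord F N p.K k).avg U) *
        (chiSeqOfRecord F N θ.ν θ.τ9.M (gOfRecord₁₃ F N θ.toStage13Params p) p.K k s'.init U *
          tkBranchOfRecord F N (FluctV N) θ.ν θ.τ9.M (gOfRecord₁₃ F N θ.toStage13Params p) p.K (WtOfRecord₁₃H F N θ p s'.init) s'.init S₀ k (fun ω => (sect2Operand F N (FluctV N) p.K (settingOfRecord₁₃ F N θ.toStage13Params p) (θ.rzAt p s'.init) s'.init (t s'.init) (Ek s'.init)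
            (UbgOfRecord₁₃CoP F N θ.toStage13Params p k s'.init)) (S₀, fun j => (ω j).2) (fun j => (ω j).1)) (baseCfg k U)))
          ((MeasurableEquiv.piEquivPiSubtypeProd (fun _ : PBond (F.P p.K) k => SU N)
              (· ∈ (Set.toFinite (bondsIn k (s'.Ω (k + 1))ᶜ)).toFinset)).symm (y, u)) = 0) ∧
      (∀ᵐ q ∂((Measure.pi fun _ : {c : PBond (F.P p.K) (k + 1) // c ∉ (Set.toFinite (bondsIn (k + 1) (s'.Ω (k + 1))ᶜ)).toFinset} => (HaarData.haar : Measure (SU N))).prod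
          (Measure.pi fun _ : ↥(Set.toFinite (bondsIn k ((s'.Λ (k + 1))ᶜ ∩ s'.Ω (k + 1)))).toFinset => (volume : Measure (FluctV N)))),
        ∫ x, (J S₀ y (q.1, (q.2, x)) : ℝ) * (fun U => wOfRecord₉ F N θ.toStage9Params p (gOfRecord₁₃ F N θ.toStage13Params p) k s' U ((avOfRecord F N p.K k).avg U) *
        (chiSeqOfRecord F N θ.ν θ.τ9.M (gOfRecord₁₃ F N θ.toStage13Params p) p.K k s'.init U *
          tkBranchOfRecord F N (FluctV N) θ.ν θ.τ9.M (gOfRecord₁₃ F N θ.toStage13Params p) p.K (WtOfRecord₁₃H F N θ p s'.init) s'.init S₀ k (fun ω => (sect2Operand F N (FluctV N) p.K (settingOfRecord₁₃ F N θ.toStage13Params p) (θ.rzAt p s'.init) s'.init (t s'.init) (Ek s'.init)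
            (UbgOfRecord₁₃CoP F N θ.toStage13Params p k s'.init)) (S₀, fun j => (ω j).2) (fun j => (ω j).1)) (baseCfg k U)))
          ((MeasurableEquiv.piEquivPiSubtypeProd (fun _ : PBond (F.P p.K) k => SU N)
              (· ∈ (Set.toFinite (bondsIn k (s'.Ω (k + 1))ᶜ)).toFinset)).symm (y, Ψ S₀ y (q.1, (q.2, x)))) ∂(τ S₀ y) =
        (WtOfRecord₁₃H F N θ p s').ζ k (s'.Ω (k + 1))ᶜ
          (Function.update (baseCfg (k + 1) ((MeasurableEquiv.piEquivPiSubtypeProd (fun _ : PBond (F.P p.K) (k + 1) => SU N)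
              (· ∈ (Set.toFinite (bondsIn (k + 1) (s'.Ω (k + 1))ᶜ)).toFinset)).symm (avgRestrOfRecord F N p.K k (Set.toFinite (bondsIn k (s'.Ω (k + 1))ᶜ)).toFinset
                (Set.toFinite (bondsIn (k + 1) (s'.Ω (k + 1))ᶜ)).toFinset y, q.1))) k
            (Function.updateFinset ((baseCfg (V := FluctV N) (k + 1) ((MeasurableEquiv.piEquivPiSubtypeProd (fun _ : PBond (F.P p.K) (k + 1) => SU N)
              (· ∈ (Set.toFinite (bondsIn (k + 1) (s'.Ω (k + 1))ᶜ)).toFinset)).symm (avgRestrOfRecord F N p.K k (Set.toFinite (bondsIn k (s'.Ω (k + 1))ᶜ)).toFinset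
                (Set.toFinite (bondsIn (k + 1) (s'.Ω (k + 1))ᶜ)).toFinset y, q.1))) k).1 (Set.toFinite (bondsIn k (s'.Ω (k + 1))ᶜ)).toFinset y,
              ((baseCfg (V := FluctV N) (k + 1) ((MeasurableEquiv.piEquivPiSubtypeProd (fun _ : PBond (F.P p.K) (k + 1) => SU N)
              (· ∈ (Set.toFinite (bondsIn (k + 1) (s'.Ω (k + 1))ᶜ)).toFinset)).symm (avgRestrOfRecord F N p.K k (Set.toFinite (bondsIn k (s'.Ω (k + 1))ᶜ)).toFinset
                (Set.toFinite (bondsIn (k + 1) (s'.Ω (k + 1))ᶜ)).toFinset y, q.1))) k).2)) *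
        ∑ Y ∈ (Set.toFinite {Y : Set (Site (F.P p.K) 0) | Y ∈ SClassOfRecord F θ.ν (gOfRecord₁₃ F N θ.toStage13Params p) p.K (k + 1) ∧ Y ⊆ s'.Ω (k + 1) ∩ (s'.Λ (k + 1))ᶜ}).toFinset,
          ((genDataOfRecord F N (FluctV N) θ.ν θ.τ9.M (gOfRecord₁₃ F N θ.toStage13Params p) p.K (WtOfRecord₁₃H F N θ p s') s' (Function.update S₀ (k + 1) Y) k).w
            (Function.update (Function.update (baseCfg (k + 1) ((MeasurableEquiv.piEquivPiSubtypeProd (fun _ : PBond (F.P p.K) (k + 1) => SU N)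
              (· ∈ (Set.toFinite (bondsIn (k + 1) (s'.Ω (k + 1))ᶜ)).toFinset)).symm (avgRestrOfRecord F N p.K k (Set.toFinite (bondsIn k (s'.Ω (k + 1))ᶜ)).toFinset
                (Set.toFinite (bondsIn (k + 1) (s'.Ω (k + 1))ᶜ)).toFinset y, q.1))) k
            (Function.updateFinset ((baseCfg (V := FluctV N) (k + 1) ((MeasurableEquiv.piEquivPiSubtypeProd (fun _ : PBond (F.P p.K) (k + 1) => SU N)
              (· ∈ (Set.toFinite (bondsIn (k + 1) (s'.Ω (k + 1))ᶜ)).toFinset)).symm (avgRestrOfRecord F N p.K k (Set.toFinite (bondsIn k (s'.Ω (k + 1))ᶜ)).toFinset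
                (Set.toFinite (bondsIn (k + 1) (s'.Ω (k + 1))ᶜ)).toFinset y, q.1))) k).1 (Set.toFinite (bondsIn k (s'.Ω (k + 1))ᶜ)).toFinset y,
              ((baseCfg (V := FluctV N) (k + 1) ((MeasurableEquiv.piEquivPiSubtypeProd (fun _ : PBond (F.P p.K) (k + 1) => SU N)
              (· ∈ (Set.toFinite (bondsIn (k + 1) (s'.Ω (k + 1))ᶜ)).toFinset)).symm (avgRestrOfRecord F N p.K k (Set.toFinite (bondsIn k (s'.Ω (k + 1))ᶜ)).toFinset
                (Set.toFinite (bondsIn (k + 1) (s'.Ω (k + 1))ᶜ)).toFinset y, q.1))) k).2)) k (insA (Set.toFinite (bondsIn k ((s'.Λ (k + 1))ᶜ ∩ s'.Ω (k + 1)))).toFinset q.2 ((Function.update (baseCfg (k + 1) ((MeasurableEquiv.piEquivPiSubtypeProd (fun _ : PBond (F.P p.K) (k + 1) => SU N)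
              (· ∈ (Set.toFinite (bondsIn (k + 1) (s'.Ω (k + 1))ᶜ)).toFinset)).symm (avgRestrOfRecord F N p.K k (Set.toFinite (bondsIn k (s'.Ω (k + 1))ᶜ)).toFinset
                (Set.toFinite (bondsIn (k + 1) (s'.Ω (k + 1))ᶜ)).toFinset y, q.1))) k
            (Function.updateFinset ((baseCfg (V := FluctV N) (k + 1) ((MeasurableEquiv.piEquivPiSubtypeProd (fun _ : PBond (F.P p.K) (k + 1) => SU N)
              (· ∈ (Set.toFinite (bondsIn (k + 1) (s'.Ω (k + 1))ᶜ)).toFinset)).symm (avgRestrOfRecord F N p.K k (Set.toFinite (bondsIn k (s'.Ω (k + 1))ᶜ)).toFinset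
                (Set.toFinite (bondsIn (k + 1) (s'.Ω (k + 1))ᶜ)).toFinset y, q.1))) k).1 (Set.toFinite (bondsIn k (s'.Ω (k + 1))ᶜ)).toFinset y,
              ((baseCfg (V := FluctV N) (k + 1) ((MeasurableEquiv.piEquivPiSubtypeProd (fun _ : PBond (F.P p.K) (k + 1) => SU N)
              (· ∈ (Set.toFinite (bondsIn (k + 1) (s'.Ω (k + 1))ᶜ)).toFinset)).symm (avgRestrOfRecord F N p.K k (Set.toFinite (bondsIn k (s'.Ω (k + 1))ᶜ)).toFinset
                (Set.toFinite (bondsIn (k + 1) (s'.Ω (k + 1))ᶜ)).toFinset y, q.1))) k).2)) k))) *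
          (tkBranchOfRecord F N (FluctV N) θ.ν θ.τ9.M (gOfRecord₁₃ F N θ.toStage13Params p) p.K (WtOfRecord₁₃H F N θ p s') s'.init S₀ k
                (fun ω => (sect2Operand F N (FluctV N) p.K (settingOfRecord₁₃ F N θ.toStage13Params p) (θ.rzAt p s') s' t' E'
                  (UbgOfRecord₁₃CoP F N θ.toStage13Params p (k + 1) s')) (Function.update S₀ (k + 1) Y, fun j => (ω j).2) (fun j => (ω j).1)))
            (Function.update (Function.update (baseCfg (k + 1) ((MeasurableEquiv.piEquivPiSubtypeProd (fun _ : PBond (F.P p.K) (k + 1) => SU N)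
              (· ∈ (Set.toFinite (bondsIn (k + 1) (s'.Ω (k + 1))ᶜ)).toFinset)).symm (avgRestrOfRecord F N p.K k (Set.toFinite (bondsIn k (s'.Ω (k + 1))ᶜ)).toFinset
                (Set.toFinite (bondsIn (k + 1) (s'.Ω (k + 1))ᶜ)).toFinset y, q.1))) k
            (Function.updateFinset ((baseCfg (V := FluctV N) (k + 1) ((MeasurableEquiv.piEquivPiSubtypeProd (fun _ : PBond (F.P p.K) (k + 1) => SU N)
              (· ∈ (Set.toFinite (bondsIn (k + 1) (s'.Ω (k + 1))ᶜ)).toFinset)).symm (avgRestrOfRecord F N p.K k (Set.toFinite (bondsIn k (s'.Ω (k + 1))ᶜ)).toFinset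
                (Set.toFinite (bondsIn (k + 1) (s'.Ω (k + 1))ᶜ)).toFinset y, q.1))) k).1 (Set.toFinite (bondsIn k (s'.Ω (k + 1))ᶜ)).toFinset y,
              ((baseCfg (V := FluctV N) (k + 1) ((MeasurableEquiv.piEquivPiSubtypeProd (fun _ : PBond (F.P p.K) (k + 1) => SU N)
              (· ∈ (Set.toFinite (bondsIn (k + 1) (s'.Ω (k + 1))ᶜ)).toFinset)).symm (avgRestrOfRecord F N p.K k (Set.toFinite (bondsIn k (s'.Ω (k + 1))ᶜ)).toFinset
                (Set.toFinite (bondsIn (k + 1) (s'.Ω (k + 1))ᶜ)).toFinset y, q.1))) k).2)) k (insA (Set.toFinite (bondsIn k ((s'.Λ (k + 1))ᶜ ∩ s'.Ω (k + 1)))).toFinset q.2 ((Function.update (baseCfg (k + 1) ((MeasurableEquiv.piEquivPiSubtypeProd (fun _ : PBond (F.P p.K) (k + 1) => SU N)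
              (· ∈ (Set.toFinite (bondsIn (k + 1) (s'.Ω (k + 1))ᶜ)).toFinset)).symm (avgRestrOfRecord F N p.K k (Set.toFinite (bondsIn k (s'.Ω (k + 1))ᶜ)).toFinset
                (Set.toFinite (bondsIn (k + 1) (s'.Ω (k + 1))ᶜ)).toFinset y, q.1))) k
            (Function.updateFinset ((baseCfg (V := FluctV N) (k + 1) ((MeasurableEquiv.piEquivPiSubtypeProd (fun _ : PBond (F.P p.K) (k + 1) => SU N)
              (· ∈ (Set.toFinite (bondsIn (k + 1) (s'.Ω (k + 1))ᶜ)).toFinset)).symm (avgRestrOfRecord F N p.K k (Set.toFinite (bondsIn k (s'.Ω (k + 1))ᶜ)).toFinset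
                (Set.toFinite (bondsIn (k + 1) (s'.Ω (k + 1))ᶜ)).toFinset y, q.1))) k).1 (Set.toFinite (bondsIn k (s'.Ω (k + 1))ᶜ)).toFinset y,
              ((baseCfg (V := FluctV N) (k + 1) ((MeasurableEquiv.piEquivPiSubtypeProd (fun _ : PBond (F.P p.K) (k + 1) => SU N)
              (· ∈ (Set.toFinite (bondsIn (k + 1) (s'.Ω (k + 1))ᶜ)).toFinset)).symm (avgRestrOfRecord F N p.K k (Set.toFinite (bondsIn k (s'.Ω (k + 1))ᶜ)).toFinset
                (Set.toFinite (bondsIn (k + 1) (s'.Ω (k + 1))ᶜ)).toFinset y, q.1))) k).2)) k)))))) :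
    slotsTOfRecord F N θ.ν θ.τ9 (EOfRecord₁₃ F N θ.toStage13Params) (wOfRecord₉ F N θ.toStage9Params) θ.ppSel p (gOfRecord₁₃ F N θ.toStage13Params p) (k + 1) s' = 0 ∨
      ∀ᵐ V' ∂fieldMeasure (F.P p.K) (k + 1) (SU N),
        chiSeqOfRecord F N θ.ν θ.τ9.M (gOfRecord₁₃ F N θ.toStage13Params p) p.K (k + 1) s' V' ≠ 0 →
          slotsTOfRecord F N θ.ν θ.τ9 (EOfRecord₁₃ F N θ.toStage13Params) (wOfRecord₉ F N θ.toStage9Params) θ.ppSel p (gOfRecord₁₃ F N θ.toStage13Params p) (k + 1) s' V' =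
            sect2Slot F N (FluctV N) p.K (settingOfRecord₁₃ F N θ.toStage13Params p) (θ.rzAt p s') (WtOfRecord₁₃H F N θ p s') s' t' E'
              (UbgOfRecord₁₃CoP F N θ.toStage13Params p (k + 1) s') V' := by
  rcases (hform.2 s'.init).2 with h0 | hae
  · exact Or.inl (slotsTOfRecord_succ_eq_zero_of_init_eq_zero F N θ.ν θ.τ9 _ _ θ.ppSel p _ _ s' h0)
  -- the piece's rows are theorems of the core provisos
  have hG := hG_at_record₁₃_of_provisos θ h p hkK s'
  have hζ0 := zetaOfRecord_nonneg F N θ.ν θ.τ9.M h.zetaUnity h.zetaAbs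
  have hw0 : ∀ U, 0 ≤ wOfRecord₉ F N θ.toStage9Params p (gOfRecord₁₃ F N θ.toStage13Params p) k s' U ((avOfRecord F N p.K k).avg U) :=
    fun U => wOfRecord_nonneg F N θ.ν θ.τ9.M p _ k θ.A₁ hζ0 s' U _
  have hgr : Measurable fun U : GaugeField (F.P p.K) k (SU N) => ((avOfRecord F N p.K k).avg U, U) :=
    (avOfRecord_measurable F N p.K k).prodMk measurable_id
  have hwm : Measurable fun U => wOfRecord₉ F N θ.toStage9Params p (gOfRecord₁₃ F N θ.toStage13Params p) k s' U ((avOfRecord F N p.K k).avg U) := by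
    have h' := ((h.tstep p k hkK).measW s').comp hgr
    exact h'
  have hχm : Measurable fun U => chiSeqOfRecord F N θ.ν θ.τ9.M (gOfRecord₁₃ F N θ.toStage13Params p) p.K k s'.init U :=
    measurable_chiSeqOfRecord_of_localBg (localBgMeasurable F N θ.ν) θ.τ9.M _ p.K k s'.init
  have hG₀ := integrable_oldBranch_pieces₁₃H_of_integrable_graph θ p s' t Ek hG hae h.zhLaws hw0 hwm hχm hζ0m hqm hΦ₀m
  -- the intrinsic reading is measurable and nonnegative
  have hW := WtOfRecord₁₃H_laws h.zhLaws p s'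
  have hRm := fun S₀ (h₀ : S₀ ∈ admSOfRecord F θ.ν θ.τ9.M (gOfRecord₁₃ F N θ.toStage13Params p) p.K k s'.init) =>
    measurable_intrinsicReading_of_hgm θ.ν θ.τ9.M (gOfRecord₁₃ F N θ.toStage13Params p) p (hdec := hdec) (hdec' := hdec') s' (WtOfRecord₁₃H F N θ p s')
      (sect2Operand F N (FluctV N) p.K (settingOfRecord₁₃ F N θ.toStage13Params p) (θ.rzAt p s') s' t' E'
                  (UbgOfRecord₁₃CoP F N θ.toStage13Params p (k + 1) s')) (hgm_at_record₁₃_of_rows θ p (hdec := hdec) (hdec' := hdec') s' t' E' hζm hqm' hΦm) S₀ h₀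
  have hR0 : ∀ (S₀ : ℕ → Set (Site (F.P p.K) 0)) (z : ((↥(Set.toFinite (bondsIn k (s'.Ω (k + 1))ᶜ)).toFinset → SU N) × ({c : PBond (F.P p.K) (k + 1) // c ∉ (Set.toFinite (bondsIn (k + 1) (s'.Ω (k + 1))ᶜ)).toFinset} → SU N))), 0 ≤ ∑ Y ∈ (Set.toFinite {Y : Set (Site (F.P p.K) 0) | Y ∈ SClassOfRecord F θ.ν (gOfRecord₁₃ F N θ.toStage13Params p) p.K (k + 1) ∧ Y ⊆ s'.Ω (k + 1) ∩ (s'.Λ (k + 1))ᶜ}).toFinset,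
            zetaOp (genDataOfRecord F N (FluctV N) θ.ν θ.τ9.M (gOfRecord₁₃ F N θ.toStage13Params p) p.K (WtOfRecord₁₃H F N θ p s') s' (Function.update S₀ (k + 1) Y) k).ζ
              (aOp k (genDataOfRecord F N (FluctV N) θ.ν θ.τ9.M (gOfRecord₁₃ F N θ.toStage13Params p) p.K (WtOfRecord₁₃H F N θ p s') s' (Function.update S₀ (k + 1) Y) k).sA
                (genDataOfRecord F N (FluctV N) θ.ν θ.τ9.M (gOfRecord₁₃ F N θ.toStage13Params p) p.K (WtOfRecord₁₃H F N θ p s') s' (Function.update S₀ (k + 1) Y) k).w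
                (tkBranchOfRecord F N (FluctV N) θ.ν θ.τ9.M (gOfRecord₁₃ F N θ.toStage13Params p) p.K (WtOfRecord₁₃H F N θ p s') s'.init S₀ k
                  (fun ω => (sect2Operand F N (FluctV N) p.K (settingOfRecord₁₃ F N θ.toStage13Params p) (θ.rzAt p s') s' t' E'
                    (UbgOfRecord₁₃CoP F N θ.toStage13Params p (k + 1) s')) (Function.update S₀ (k + 1) Y, fun j => (ω j).2) (fun j => (ω j).1))))
              (Function.update (baseCfg (k + 1) ((MeasurableEquiv.piEquivPiSubtypeProd (fun _ : PBond (F.P p.K) (k + 1) => SU N)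
                (· ∈ (Set.toFinite (bondsIn (k + 1) (s'.Ω (k + 1))ᶜ)).toFinset)).symm (avgRestrOfRecord F N p.K k (Set.toFinite (bondsIn k (s'.Ω (k + 1))ᶜ)).toFinset
                  (Set.toFinite (bondsIn (k + 1) (s'.Ω (k + 1))ᶜ)).toFinset z.1, z.2))) k
              (Function.updateFinset ((baseCfg (V := FluctV N) (k + 1) ((MeasurableEquiv.piEquivPiSubtypeProd (fun _ : PBond (F.P p.K) (k + 1) => SU N)
                (· ∈ (Set.toFinite (bondsIn (k + 1) (s'.Ω (k + 1))ᶜ)).toFinset)).symm (avgRestrOfRecord F N p.K k (Set.toFinite (bondsIn k (s'.Ω (k + 1))ᶜ)).toFinset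
                  (Set.toFinite (bondsIn (k + 1) (s'.Ω (k + 1))ᶜ)).toFinset z.1, z.2))) k).1 (Set.toFinite (bondsIn k (s'.Ω (k + 1))ᶜ)).toFinset z.1,
                ((baseCfg (V := FluctV N) (k + 1) ((MeasurableEquiv.piEquivPiSubtypeProd (fun _ : PBond (F.P p.K) (k + 1) => SU N)
                (· ∈ (Set.toFinite (bondsIn (k + 1) (s'.Ω (k + 1))ᶜ)).toFinset)).symm (avgRestrOfRecord F N p.K k (Set.toFinite (bondsIn k (s'.Ω (k + 1))ᶜ)).toFinset
                  (Set.toFinite (bondsIn (k + 1) (s'.Ω (k + 1))ᶜ)).toFinset z.1, z.2))) k).2)) := fun S₀ z =>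
    Finset.sum_nonneg fun Y _ => by
      rw [zetaOp_apply]
      exact mul_nonneg ((genDataOfRecord_laws F N (FluctV N) θ.ν θ.τ9.M (gOfRecord₁₃ F N θ.toStage13Params p) p.K hW s' (Function.update S₀ (k + 1) Y) k).zeta_nonneg _)
        (aOp_nonneg k _ (genDataOfRecord_laws F N (FluctV N) θ.ν θ.τ9.M (gOfRecord₁₃ F N θ.toStage13Params p) p.K hW s' (Function.update S₀ (k + 1) Y) k).w_nonneg
          (tkBranchOfRecord_nonneg θ.ν θ.τ9.M (gOfRecord₁₃ F N θ.toStage13Params p) p.K hW s'.init S₀ k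
            (fun ω => (sect2Operand_pos p.K _ _ s' t' E' _ (Function.update S₀ (k + 1) Y, fun j => (ω j).2) (fun j => (ω j).1)).le)) _)
  -- the new weights' rows and the integrability of the pieces through the glue
  have hζWm : ∀ j Y, Measurable ((WtOfRecord₁₃H F N θ p s').ζ j Y) := fun j Y =>
    measurable_tkWeightsOfRecordP_ζ F N (FluctV N) θ.ν θ.A₁ p (gOfRecord₁₃ F N θ.toStage13Params p) (θ.zhAt p s') j Y (hζm j Y)
  have hwWm : ∀ j Λ' Y S, Measurable ((WtOfRecord₁₃H F N θ p s').w j Λ' Y S) := fun j Λ' Y S =>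
    measurable_tkWeightsOfRecordP_w F N (FluctV N) θ.ν θ.A₁ p (gOfRecord₁₃ F N θ.toStage13Params p) (θ.zhAt p s') j Λ' Y S (hqm' j Λ')
  have hpres := measurePreserving_piEquivPiSubtypeProd_symm_fieldMeasure (G := SU N) (P := F.P p.K) (j := k) (Set.toFinite (bondsIn k (s'.Ω (k + 1))ᶜ)).toFinset
  -- per old branch: the chart family in `…N11FibrewiseIdentityOfFibreChart`'s letters, the reading produced by `reading_of_keptSplit_at_record`
  have hchart : ∀ S₀ (h₀ : S₀ ∈ admSOfRecord F θ.ν θ.τ9.M (gOfRecord₁₃ F N θ.toStage13Params p) p.K k s'.init),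
      ∀ᵐ y ∂(Measure.pi fun _ : ↥(Set.toFinite (bondsIn k (s'.Ω (k + 1))ᶜ)).toFinset => (HaarData.haar : Measure (SU N))),
      Measurable (Ψ S₀ y) ∧ Measurable (J S₀ y) ∧
      ((((Measure.pi fun _ : {c : PBond (F.P p.K) (k + 1) // c ∉ (Set.toFinite (bondsIn (k + 1) (s'.Ω (k + 1))ᶜ)).toFinset} => (HaarData.haar : Measure (SU N))) ⊗ₘ
          (fun y => Kernel.const _ ((Measure.pi fun _ : ↥(Set.toFinite (bondsIn k ((s'.Λ (k + 1))ᶜ ∩ s'.Ω (k + 1)))).toFinset => (volume : Measure (FluctV N))).prod (τ S₀ y))) y).withDensity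
          (fun z => (J S₀ y z : ℝ≥0∞))).map (Ψ S₀ y) =
        (Measure.pi fun _ : {b : PBond (F.P p.K) k // b ∉ (Set.toFinite (bondsIn k (s'.Ω (k + 1))ᶜ)).toFinset} => (HaarData.haar : Measure (SU N))).restrict (Sc S₀ y)) ∧
      (∀ᵐ z ∂(((Measure.pi fun _ : {c : PBond (F.P p.K) (k + 1) // c ∉ (Set.toFinite (bondsIn (k + 1) (s'.Ω (k + 1))ᶜ)).toFinset} => (HaarData.haar : Measure (SU N))) ⊗ₘ
          (fun y => Kernel.const _ ((Measure.pi fun _ : ↥(Set.toFinite (bondsIn k ((s'.Λ (k + 1))ᶜ ∩ s'.Ω (k + 1)))).toFinset => (volume : Measure (FluctV N))).prod (τ S₀ y))) y).withDensity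
          (fun z => (J S₀ y z : ℝ≥0∞))),
        (fun c : {c : PBond (F.P p.K) (k + 1) // c ∉ (Set.toFinite (bondsIn (k + 1) (s'.Ω (k + 1))ᶜ)).toFinset} =>
          (avOfRecord F N p.K k).avg ((MeasurableEquiv.piEquivPiSubtypeProd (fun _ : PBond (F.P p.K) k => SU N)
              (· ∈ (Set.toFinite (bondsIn k (s'.Ω (k + 1))ᶜ)).toFinset)).symm (y, Ψ S₀ y z)) c) = z.1) ∧
      (∀ u, u ∉ Sc S₀ y → (fun U => wOfRecord₉ F N θ.toStage9Params p (gOfRecord₁₃ F N θ.toStage13Params p) k s' U ((avOfRecord F N p.K k).avg U) *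
        (chiSeqOfRecord F N θ.ν θ.τ9.M (gOfRecord₁₃ F N θ.toStage13Params p) p.K k s'.init U *
          tkBranchOfRecord F N (FluctV N) θ.ν θ.τ9.M (gOfRecord₁₃ F N θ.toStage13Params p) p.K (WtOfRecord₁₃H F N θ p s'.init) s'.init S₀ k (fun ω => (sect2Operand F N (FluctV N) p.K (settingOfRecord₁₃ F N θ.toStage13Params p) (θ.rzAt p s'.init) s'.init (t s'.init) (Ek s'.init)
            (UbgOfRecord₁₃CoP F N θ.toStage13Params p k s'.init)) (S₀, fun j => (ω j).2) (fun j => (ω j).1)) (baseCfg k U)))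
          ((MeasurableEquiv.piEquivPiSubtypeProd (fun _ : PBond (F.P p.K) k => SU N)
              (· ∈ (Set.toFinite (bondsIn k (s'.Ω (k + 1))ᶜ)).toFinset)).symm (y, u)) = 0) ∧
      ((fun v => ∫ x, (J S₀ y (v, x) : ℝ) * (fun U => wOfRecord₉ F N θ.toStage9Params p (gOfRecord₁₃ F N θ.toStage13Params p) k s' U ((avOfRecord F N p.K k).avg U) *
        (chiSeqOfRecord F N θ.ν θ.τ9.M (gOfRecord₁₃ F N θ.toStage13Params p) p.K k s'.init U *
          tkBranchOfRecord F N (FluctV N) θ.ν θ.τ9.M (gOfRecord₁₃ F N θ.toStage13Params p) p.K (WtOfRecord₁₃H F N θ p s'.init) s'.init S₀ k (fun ω => (sect2Operand F N (FluctV N) p.K (settingOfRecord₁₃ F N θ.toStage13Params p) (θ.rzAt p s'.init) s'.init (t s'.init) (Ek s'.init)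
            (UbgOfRecord₁₃CoP F N θ.toStage13Params p k s'.init)) (S₀, fun j => (ω j).2) (fun j => (ω j).1)) (baseCfg k U)))
          ((MeasurableEquiv.piEquivPiSubtypeProd (fun _ : PBond (F.P p.K) k => SU N)
              (· ∈ (Set.toFinite (bondsIn k (s'.Ω (k + 1))ᶜ)).toFinset)).symm (y, Ψ S₀ y (v, x))) ∂((fun y => Kernel.const _ ((Measure.pi fun _ : ↥(Set.toFinite (bondsIn k ((s'.Λ (k + 1))ᶜ ∩ s'.Ω (k + 1)))).toFinset => (volume : Measure (FluctV N))).prod (τ S₀ y))) y v))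
        =ᵐ[(Measure.pi fun _ : {c : PBond (F.P p.K) (k + 1) // c ∉ (Set.toFinite (bondsIn (k + 1) (s'.Ω (k + 1))ᶜ)).toFinset} => (HaarData.haar : Measure (SU N)))] fun v => ∑ Y ∈ (Set.toFinite {Y : Set (Site (F.P p.K) 0) | Y ∈ SClassOfRecord F θ.ν (gOfRecord₁₃ F N θ.toStage13Params p) p.K (k + 1) ∧ Y ⊆ s'.Ω (k + 1) ∩ (s'.Λ (k + 1))ᶜ}).toFinset,
          zetaOp (genDataOfRecord F N (FluctV N) θ.ν θ.τ9.M (gOfRecord₁₃ F N θ.toStage13Params p) p.K (WtOfRecord₁₃H F N θ p s') s' (Function.update S₀ (k + 1) Y) k).ζ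
            (aOp k (genDataOfRecord F N (FluctV N) θ.ν θ.τ9.M (gOfRecord₁₃ F N θ.toStage13Params p) p.K (WtOfRecord₁₃H F N θ p s') s' (Function.update S₀ (k + 1) Y) k).sA
              (genDataOfRecord F N (FluctV N) θ.ν θ.τ9.M (gOfRecord₁₃ F N θ.toStage13Params p) p.K (WtOfRecord₁₃H F N θ p s') s' (Function.update S₀ (k + 1) Y) k).w
              (tkBranchOfRecord F N (FluctV N) θ.ν θ.τ9.M (gOfRecord₁₃ F N θ.toStage13Params p) p.K (WtOfRecord₁₃H F N θ p s') s'.init S₀ k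
                (fun ω => (sect2Operand F N (FluctV N) p.K (settingOfRecord₁₃ F N θ.toStage13Params p) (θ.rzAt p s') s' t' E'
                  (UbgOfRecord₁₃CoP F N θ.toStage13Params p (k + 1) s')) (Function.update S₀ (k + 1) Y, fun j => (ω j).2) (fun j => (ω j).1))))
            (Function.update (baseCfg (k + 1) ((MeasurableEquiv.piEquivPiSubtypeProd (fun _ : PBond (F.P p.K) (k + 1) => SU N)
              (· ∈ (Set.toFinite (bondsIn (k + 1) (s'.Ω (k + 1))ᶜ)).toFinset)).symm (avgRestrOfRecord F N p.K k (Set.toFinite (bondsIn k (s'.Ω (k + 1))ᶜ)).toFinset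
                (Set.toFinite (bondsIn (k + 1) (s'.Ω (k + 1))ᶜ)).toFinset y, v))) k
            (Function.updateFinset ((baseCfg (V := FluctV N) (k + 1) ((MeasurableEquiv.piEquivPiSubtypeProd (fun _ : PBond (F.P p.K) (k + 1) => SU N)
              (· ∈ (Set.toFinite (bondsIn (k + 1) (s'.Ω (k + 1))ᶜ)).toFinset)).symm (avgRestrOfRecord F N p.K k (Set.toFinite (bondsIn k (s'.Ω (k + 1))ᶜ)).toFinset
                (Set.toFinite (bondsIn (k + 1) (s'.Ω (k + 1))ᶜ)).toFinset y, v))) k).1 (Set.toFinite (bondsIn k (s'.Ω (k + 1))ᶜ)).toFinset y,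
              ((baseCfg (V := FluctV N) (k + 1) ((MeasurableEquiv.piEquivPiSubtypeProd (fun _ : PBond (F.P p.K) (k + 1) => SU N)
              (· ∈ (Set.toFinite (bondsIn (k + 1) (s'.Ω (k + 1))ᶜ)).toFinset)).symm (avgRestrOfRecord F N p.K k (Set.toFinite (bondsIn k (s'.Ω (k + 1))ᶜ)).toFinset
                (Set.toFinite (bondsIn (k + 1) (s'.Ω (k + 1))ᶜ)).toFinset y, v))) k).2))) := by
    intro S₀ h₀
    have hρ' := (hpres.integrable_comp (hG₀ S₀ h₀).aestronglyMeasurable).mpr (hG₀ S₀ h₀)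
    filter_upwards [hsplit S₀ h₀, hρ'.prod_right_ae] with y ⟨hΨ, hJ, hpush, hsec, hρS, hpt⟩ hρy
    refine ⟨hΨ, hJ, ?_, ?_, hρS, ?_⟩
    · rw [Measure.compProd_const]; exact hpush
    · rw [Measure.compProd_const]; exact hsec
    · simp only [Kernel.const_apply]
      exact reading_of_keptSplit_at_record θ.ν θ.τ9.M (gOfRecord₁₃ F N θ.toStage13Params p) p (hdec := hdec) (hdec' := hdec') s' hW hζWm hwWm
        (fun 𝔞 U => sect2Operand F N (FluctV N) p.K (settingOfRecord₁₃ F N θ.toStage13Params p) (θ.rzAt p s') s' t' E'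
          (UbgOfRecord₁₃CoP F N θ.toStage13Params p (k + 1) s') 𝔞 U)
        (fun 𝔞 U => (sect2Operand_pos p.K _ _ s' t' E' _ 𝔞 U).le) hΦm S₀ h₀ y (τ S₀ y) hρy hΨ hJ hpush hpt
  exact slotsTOfRecord₁₃H_succ_O3_of_hasSect2FormAtZS_of_oldBranchCondExp_of_provisos θ h p hkK (hdec := hdec) (hdec' := hdec') hk s' hform t' E'
    hζ0m hqm hΦ₀m hζm hqm' hΦm fun S₀ h₀ =>
      condExp_identity_of_fibreCharts_of_nonneg θ.ν θ.τ9.M (gOfRecord₁₃ F N θ.toStage13Params p) p (hdec := hdec) (hdec' := hdec') hk s' (hG₀ S₀ h₀)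
        (fun y => Kernel.const _ ((Measure.pi fun _ : ↥(Set.toFinite (bondsIn k ((s'.Λ (k + 1))ᶜ ∩ s'.Ω (k + 1)))).toFinset => (volume : Measure (FluctV N))).prod (τ S₀ y)))
        (hκ := fun y => inferInstance) (Ψ S₀) (J S₀) (Sc S₀) (hchart S₀ h₀) (hR0 S₀) (hRm S₀ h₀)

end Stage13

end Summit.QuantumFields.YangMills.Theorems.BalabanUVNodesN11O3OfSplitChartsAtRecord13

end
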